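import Summits.HubbardSuperconductivity.HubbardLadder.Bounds.CouplingPolymerGas
import Summits.HubbardSuperconductivity.HubbardLadder.Bounds.TwistedBondDictionary
import Literature.MathematicalPhysics.QuantumLattice.HubbardHighTemperatureTwoPoint
import HarnessLib

/-!
# Polymer representation for bond-dependent couplings, and twist-blind activities of the
# `t–t'` torus (pub-hubbard BOUNDS, Theorem 12 — Lemma 12.2 and the column step, KERNEL-PROVED)

LINT.SIZE SPLIT (bounds g25 amendment 2026-08-21, same request number #181.4): the section
`General` (restricted couplings, `bondWeightC`, `siteActivityC`, `polymerGasZ`, Cauchy bound) of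
the original #181.4 file now live in `Bounds/CouplingPolymerGas.lean` (#181.4a), imported here;
every declaration is byte-identical to the staged v1 and in the original order.

HONEST FRAMING: ladder R1–R4 with certified numbers; no claim on H/H₀. Rigorous statements about a
MODEL CLASS (the `t–t'` Hubbard torus with on-site interaction), no materials claim.

Cell tree `Summits/HubbardSuperconductivity/HubbardLadder/Bounds/` (programme-internal; nothing
here is a cited Literature fact). The tree's polymer representation of the Hubbard partition
function around the atomic limit (`Literature…HubbardPolymerRepresentation`, Ueltschi 1999 §2.3/§3)
is written for a UNIFORM coupling `τ·1_K` on the bonds of a graph. bounds.tex §12 (bounds g23,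
2026-08-21), Lemma 12.2, needs it for couplings DEPENDING ON THE DIRECTED BOND (Peierls phases,
`t ≠ t'`). This file carries out that generalisation — the proofs are the tree's, with
`couplingOn τ K` replaced by the restriction `restrictCoupling c K` of an arbitrary
`c : Bond Λ → ℂ` — and then specialises to the seam-twisted `t–t'` torus of
`Bounds/TwistedBondDictionary.lean` (LEAN FILING REQUEST #181.3):

* `bondWeightC`, `bondWeightC_empty`, `bondWeightC_union` — the inclusion–exclusion bond weights
  `M_c(K) = Σ_{K' ⊆ K} (-1)^{|K∖K'|} g(c|_{K'})` and their multiplicativity over disjoint supports;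
* `Zc_eq_mul_polymerPartitionFunctionC` — `Zc(β,U,μ;c) = z₀^{|Λ|} · Ξ(siteActivityC P c)` for every
  bond set `P ⊇ supp c` (Lemma 12.2, representation part, for arbitrary bond-dependent couplings);
* `bondWeightC_eq_iterDiff`, `norm_bondWeightC_le` — the weights are iterated differences of an
  entire function, whence the tree's Cauchy bound ported: `|M_c(K)| ≤ (e² s)^{|K|} r^{|supp K|}`
  when `|c_b| ≤ s ≤ 1` (Lemma 12.3's smallness per bond in the tree's form);
* `partitionFn_hubbardTorusTT'FluxMu_eq_polymer` — the twisted `t–t'` torus: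
  `Tr e^{-β(H^{tt'}_L(t',U;θ) - μN)} = z₀^{L²} Ξ(ρ_θ)` with `ρ_θ = siteActivityC (ttBonds) (c_θ)`
  (right-hand side packaged as `polymerGasZ`; `unfold polymerGasZ` for the explicit product);
* `siteActivityC_congr_of_Zc`, `bondWeightC_ttFluxCoupling_twist_blind`,
  `siteActivityC_ttFluxCoupling_twist_blind` — `ρ_θ(A) = ρ_0(A)` for every site set `A` that
  misses a column (from #181.3 `Zc_restrict_ttFluxCoupling_eq`, i.e. the column gauge lemma #181.2);
* `le_card_of_meets_every_column`, `siteActivityC_twist_dichotomy` — hence for EVERY polymer `A`: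
  `ρ_θ(A) = ρ_0(A)` or `|A| ≥ L`. This dichotomy is the combinatorial heart of bounds.tex
  Theorem 12(i): `log Ξ_θ - log Ξ_0` is a sum over clusters containing a polymer of size `≥ L`.

Programme nodes (each `@[conjecture] def` + a kernel-checked `_holds`):
`TwistedTorusPolymerRepresentation`, `TwistBlindPolymerActivities`, `TwistedTorusBondWeightControl`.
What remains for the node `HighTemperatureTwistInsensitivityTT'` (`Bounds/HighTemperatureNoStiffness.lean`)
after this file: the Kotecký–Preiss tail estimate for clusters pinned at a polymer of size `≥ L`
(tree: `ClusterExpansion`, `HubbardPolymerBounds.sum_norm_siteActivity_mul_exp_le` to be ported to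
`siteActivityC` exactly as `norm_bondWeightC_le` is ported here).

References: Ueltschi, arXiv:cond-mat/9810320 (J. Stat. Phys. 95 (1999) 693) §2.1 (factorisation),
§2.3 (weights `ρ(𝒜)`, polymer form of `Tr e^{-βH_Λ}`), §3; Kotecký–Preiss, CMP 103 (1986) 491.
-/

noncomputable section

namespace Summit.HubbardSuperconductivity.HubbardLadder.Bounds

open Matrix Finset Literature.MathematicalPhysics.QuantumLattice
  Literature.MathematicalPhysics.QuantumFieldTheory Literature.Probability.LatticeModels
  Literature.Analysis.Complex.FiniteDifference
open scoped ComplexConjugate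
/-! ### The seam-twisted `t–t'` torus: polymer representation and twist-blind activities -/

section Torus

variable {L : ℕ} [NeZero L]

/-- The bond universe of the `t–t'` torus: the support of the untwisted coupling `c_0`
(nearest-neighbour and diagonal directed spin-bonds with nonzero amplitude). [folklore] -/
def ttBonds (L : ℕ) [NeZero L] (β t' : ℝ) : Finset (Bond (FermionTorus 2 L)) :=
  Finset.univ.filter fun b => ttFluxCoupling L β t' 0 b ≠ 0

/-- Membership in the `t–t'` bond set `ttBonds`, unfolded. [this file] -/
theorem mem_ttBonds {β t' : ℝ} {b : Bond (FermionTorus 2 L)} :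
    b ∈ ttBonds L β t' ↔ ttFluxCoupling L β t' 0 b ≠ 0 := by
  simp [ttBonds]

/-- The twisted coupling `c_θ` is supported in `ttBonds` for every twist (cocycle `c_θ = ω_θ c_0`). [folklore] -/
theorem mem_ttBonds_of_ne_zero (hL : 3 ≤ L) {β t' θ : ℝ} {b : Bond (FermionTorus 2 L)}
    (hb : ttFluxCoupling L β t' θ b ≠ 0) : b ∈ ttBonds L β t' := by
  rw [mem_ttBonds]
  intro h0
  apply hb
  rw [ttFluxCoupling_eq_seamPhase_mul hL β t' θ b, h0, mul_zero]

/- `z₀ ≠ 0` for real parameters: the tree's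
`Literature.MathematicalPhysics.QuantumLattice.SourceGas.atomicPartitionFn_real_ne_zero`
(`HubbardHighTemperatureTwoPoint`), re-exported into this namespace for the downstream files. -/
export Literature.MathematicalPhysics.QuantumLattice.SourceGas (atomicPartitionFn_real_ne_zero)

/-- **Polymer representation of the twisted `t–t'` torus** (bounds.tex Lemma 12.2 for the
Hamiltonian of Theorem 12): for `L ≥ 3` and all real `β, t', U, μ, θ`,
`Tr e^{-β(H^{tt'}_L(t',U;θ) - μN)} = z₀(β,U,μ)^{L²} · Ξ^{polyInc}_{𝒫(Λ_L)}(ρ_θ)` with the site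
activities `ρ_θ = siteActivityC (ttBonds L β t') β U μ (c_θ)`, `c_θ = ttFluxCoupling L β t' θ`.
[this file: `partitionFn_hubbardTorusTT'FluxMu_eq_Zc` (#181.3) + `Zc_eq_mul_polymerPartitionFunctionC`] -/
theorem partitionFn_hubbardTorusTT'FluxMu_eq_polymer (hL : 3 ≤ L) (β t' U μ θ : ℝ) :
    (hubbardTorusTT'Flux L t' U θ - (μ : ℂ) • totalNumber).partitionFn β =
      polymerGasZ (ttBonds L β t') (β : ℂ) (U : ℂ) (μ : ℂ) (ttFluxCoupling L β t' θ) := by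
  rw [partitionFn_hubbardTorusTT'FluxMu_eq_Zc hL]
  exact Zc_eq_polymerGasZ (atomicPartitionFn_real_ne_zero β U μ) _ _
    (fun b hb => mem_ttBonds_of_ne_zero hL hb)

/-- **Twist-blindness of the bond weights**: if no bond of `X` has an endpoint in the column `k`,
then `M_{c_θ}(X) = M_{c_0}(X)` (every `c_θ|_{K'}`, `K' ⊆ X`, is handled by the column gauge lemma,
#181.2/#181.3 `Zc_restrict_ttFluxCoupling_eq`). [this file] -/
theorem bondWeightC_ttFluxCoupling_twist_blind (hL : 3 ≤ L) (β t' U μ θ : ℝ) {k : ℕ} (hk : k < L)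
    {X : Finset (Bond (FermionTorus 2 L))} (hX : ∀ b ∈ X, col b.1 ≠ k ∧ col b.2.1 ≠ k) :
    bondWeightC (β : ℂ) (U : ℂ) (μ : ℂ) (ttFluxCoupling L β t' θ) X =
      bondWeightC (β : ℂ) (U : ℂ) (μ : ℂ) (ttFluxCoupling L β t' 0) X := by
  unfold bondWeightC
  refine Finset.sum_congr rfl fun K' hK' => ?_
  have hsub : K' ⊆ X := Finset.mem_powerset.1 hK'
  -- the `Decidable (b ∈ K')` instance inside `restrictCoupling` is the one inherited from the
  -- general section; `(_)` lets unification (not instance synthesis) supply it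
  have hZ : Zc (β : ℂ) (U : ℂ) (μ : ℂ) (restrictCoupling (ttFluxCoupling L β t' θ) K') =
      Zc (β : ℂ) (U : ℂ) (μ : ℂ) (restrictCoupling (ttFluxCoupling L β t' 0) K') :=
    @Zc_restrict_ttFluxCoupling_eq L _ hL β t' U μ θ k hk (fun b => b ∈ K') (_) (fun b hb => hX b (hsub hb))
  rw [gibbsRatio, gibbsRatio, hZ]

/-- **Twist-blindness of the site activities** (the column step of bounds.tex Theorem 12): for
every bond universe `P` and every site set `A` missing the column `k`, `ρ_θ(A) = ρ_0(A)`. [this file] -/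
theorem siteActivityC_ttFluxCoupling_twist_blind (hL : 3 ≤ L) (β t' U μ θ : ℝ) {k : ℕ} (hk : k < L)
    (P : Finset (Bond (FermionTorus 2 L))) {A : Finset (FermionTorus 2 L)} (hA : ∀ x ∈ A, col x ≠ k) :
    siteActivityC P (β : ℂ) (U : ℂ) (μ : ℂ) (ttFluxCoupling L β t' θ) A =
      siteActivityC P (β : ℂ) (U : ℂ) (μ : ℂ) (ttFluxCoupling L β t' 0) A :=
  siteActivityC_congr_of_Zc P _ _ _ fun K hK =>
    @Zc_restrict_ttFluxCoupling_eq L _ hL β t' U μ θ k hk (fun b => b ∈ K) (_)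
      (fun b hb => ⟨hA _ (hK b hb).1, hA _ (hK b hb).2⟩)

omit [NeZero L] in
/-- A site set meeting every column of the `L × L` torus has at least `L` sites. [folklore] -/
theorem le_card_of_meets_every_column {A : Finset (FermionTorus 2 L)} (hA : ∀ k < L, ∃ x ∈ A, col x = k) :
    L ≤ A.card := by
  have hsub : Finset.range L ⊆ A.image col := by
    intro k hk
    obtain ⟨x, hxA, hxk⟩ := hA k (Finset.mem_range.1 hk)
    exact Finset.mem_image.2 ⟨x, hxA, hxk⟩
  calc L = (Finset.range L).card := (Finset.card_range L).symm
    _ ≤ (A.image col).card := Finset.card_le_card hsub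
    _ ≤ A.card := Finset.card_image_le

/-- **The twist dichotomy for polymers** (combinatorial heart of bounds.tex Theorem 12(i)): every
polymer either has the same activity at twist `θ` and at `0`, or has at least `L` sites (it meets
every column, i.e. it "winds"). [this file] -/
theorem siteActivityC_twist_dichotomy (hL : 3 ≤ L) (β t' U μ θ : ℝ) (P : Finset (Bond (FermionTorus 2 L)))
    (A : Finset (FermionTorus 2 L)) :
    siteActivityC P (β : ℂ) (U : ℂ) (μ : ℂ) (ttFluxCoupling L β t' θ) A =
        siteActivityC P (β : ℂ) (U : ℂ) (μ : ℂ) (ttFluxCoupling L β t' 0) A ∨ L ≤ A.card := by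
  by_cases h : ∀ k < L, ∃ x ∈ A, col x = k
  · exact Or.inr (le_card_of_meets_every_column h)
  · simp only [not_forall, not_exists, not_and, exists_prop] at h
    obtain ⟨k, hk, hA⟩ := h
    exact Or.inl (siteActivityC_ttFluxCoupling_twist_blind hL β t' U μ θ hk P hA)

/-- **Node (bounds.tex Lemma 12.2 for the twisted `t–t'` torus — PROVED below).** For `L ≥ 3` and all
real `β, t', U, μ, θ`: `Tr e^{-β(H^{tt'}_L(t',U;θ) - μN)} = z₀^{|Λ_L|} Ξ(ρ_θ)` with
`ρ_θ = siteActivityC (ttBonds L β t') β U μ (ttFluxCoupling L β t' θ)` a hard-core subset-polymer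
gas (`polyInc` = meet-or-equal; packaged as `polymerGasZ`). [conjecture: this programme — pub-hubbard BOUNDS node, bounds.tex §12 Lemma 12.2] -/
@[conjecture]
def TwistedTorusPolymerRepresentation : Prop :=
  ∀ (L : ℕ) [NeZero L], 3 ≤ L → ∀ (β t' U μ θ : ℝ),
    (hubbardTorusTT'Flux L t' U θ - (μ : ℂ) • totalNumber).partitionFn β =
      polymerGasZ (ttBonds L β t') (β : ℂ) (U : ℂ) (μ : ℂ) (ttFluxCoupling L β t' θ)

/-- `TwistedTorusPolymerRepresentation` holds. [this file: `partitionFn_hubbardTorusTT'FluxMu_eq_polymer`] -/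
theorem twistedTorusPolymerRepresentation_holds : TwistedTorusPolymerRepresentation := by
  intro L _ hL β t' U μ θ
  exact partitionFn_hubbardTorusTT'FluxMu_eq_polymer hL β t' U μ θ

/-- **Node (the column step of bounds.tex Theorem 12 — PROVED below).** For `L ≥ 3`, every bond
universe `P`, all real `β, t', U, μ, θ` and every polymer `A ⊆ Λ_L`: either
`ρ_θ(A) = ρ_0(A)` or `L ≤ |A|`. [conjecture: this programme — pub-hubbard BOUNDS node, bounds.tex §12 (Lemma 12.5 applied in the proof of Theorem 12(i))] -/
@[conjecture]
def TwistBlindPolymerActivities : Prop :=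
  ∀ (L : ℕ) [NeZero L], 3 ≤ L → ∀ (β t' U μ θ : ℝ) (P : Finset (Bond (FermionTorus 2 L)))
    (A : Finset (FermionTorus 2 L)),
    siteActivityC P (β : ℂ) (U : ℂ) (μ : ℂ) (ttFluxCoupling L β t' θ) A =
        siteActivityC P (β : ℂ) (U : ℂ) (μ : ℂ) (ttFluxCoupling L β t' 0) A ∨ L ≤ A.card

/-- `TwistBlindPolymerActivities` holds. [this file: `siteActivityC_twist_dichotomy`] -/
theorem twistBlindPolymerActivities_holds : TwistBlindPolymerActivities := by
  intro L _ hL β t' U μ θ P A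
  exact siteActivityC_twist_dichotomy hL β t' U μ θ P A

/-- **Node (bond-level control of the twisted weights — PROVED below):** for `L ≥ 3` and all real
`β, t', U, μ, θ`: (a) twist-blindness — if no bond of `X` has an endpoint in some column `k` then
`M_{c_θ}(X) = M_{c_0}(X)`; (b) smallness per bond — if `|c_θ(b)| ≤ s ≤ 1` for all bonds then
`|M_{c_θ}(X)| ≤ (e² s)^{|X|}` (`siteRatio = 1` for real parameters). These are the two bond-level
inputs of the Kotecký–Preiss step of bounds.tex Theorem 12(i) (Lemmas 12.3 and 12.5).
[conjecture: this programme — pub-hubbard BOUNDS node, bounds.tex §12 Lemmas 12.3/12.5 at bond level] -/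
@[conjecture]
def TwistedTorusBondWeightControl : Prop :=
  ∀ (L : ℕ) [NeZero L], 3 ≤ L → ∀ (β t' U μ θ : ℝ),
    (∀ (k : ℕ), k < L → ∀ X : Finset (Bond (FermionTorus 2 L)),
        (∀ b ∈ X, col b.1 ≠ k ∧ col b.2.1 ≠ k) →
          bondWeightC (β : ℂ) (U : ℂ) (μ : ℂ) (ttFluxCoupling L β t' θ) X =
            bondWeightC (β : ℂ) (U : ℂ) (μ : ℂ) (ttFluxCoupling L β t' 0) X) ∧
    (∀ s : ℝ, 0 ≤ s → s ≤ 1 → (∀ b, ‖ttFluxCoupling L β t' θ b‖ ≤ s) →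
        ∀ X : Finset (Bond (FermionTorus 2 L)),
          ‖bondWeightC (β : ℂ) (U : ℂ) (μ : ℂ) (ttFluxCoupling L β t' θ) X‖ ≤ (Real.exp 2 * s) ^ X.card)

/-- `TwistedTorusBondWeightControl` holds. [this file: `bondWeightC_ttFluxCoupling_twist_blind`, `norm_bondWeightC_le`] -/
theorem twistedTorusBondWeightControl_holds : TwistedTorusBondWeightControl := by
  intro L _ hL β t' U μ θ
  refine ⟨fun k hk X hX => bondWeightC_ttFluxCoupling_twist_blind hL β t' U μ θ hk hX, fun s hs0 hs1 hc X => ?_⟩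
  have h := norm_bondWeightC_le (atomicPartitionFn_real_ne_zero β U μ) hs0 hs1 hc X
  rw [siteRatio_ofReal, one_pow, mul_one] at h
  exact h

end Torus

end Summit.HubbardSuperconductivity.HubbardLadder.Bounds

end
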